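import Literature.Algebra.Homology.OrderedCechPairSystemEilenbergZilber
import Literature.Algebra.Homology.OrderedCechPairSystemLexComparison
import Literature.Algebra.Homology.OrderedCechSystemBicomplex
import Mathlib.RingTheory.FiniteType
import HarnessLib

/-!
# The Künneth comparison of the ordered Čech bicomplex: `H(×)` and `H(∇)` are bijective (The Stacks Project, Tag 0BEC;
# Eilenberg–Mac Lane 1953 §5)

Layer `Literature/Algebra/Homology`, PROOF lane (theorems only; no definition, no instance, no notation, no named fact).  For a pair-system
`P : Finset ι ⥤ Finset κ ⥤ ModuleCat A` over a commutative ring `A`: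
* the cross product `× : Tot Č•,•(P) ⟶ Č(lexSystem P)` and the shuffle map `∇` back satisfy `× ≫ ∇ = 𝟙`
  (`Algebra/Homology/OrderedCechPairSystemEilenbergZilber.cross_shuffle`), so `Hⁿ(∇) ∘ Hⁿ(×) = id`;
* abstractly `Hⁿ(Tot Č•,•(P)) ≅ Hⁿ(Č(lexSystem P))` (`Algebra/Homology/OrderedCechPairSystemLexComparison.nonempty_homologyIso_total_lexSystem`,
  the algebraic Eilenberg–Zilber theorem via the lexicographic Čech resolvent, F0P1b-p06).
Hence, as soon as `Hⁿ(Č(lexSystem P))` is a FINITE `A`-module, `θ ∘ Hⁿ(∇)` is a surjective endomorphism of a finite module over a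
commutative ring, so injective (Vasconcelos ∕ Orzech, Mathlib `OrzechProperty.injective_of_surjective_endomorphism`): **`Hⁿ(∇)` and `Hⁿ(×)` are
bijective** (`bijective_homologyMap_shuffle`, `bijective_homologyMap_cross`), and for two systems `M`, `N` on finite index sets the composite
`Hⁿ(Č(M) ⊗ Č(N)) ≅ Hⁿ(Tot Č•,•(M ⊠ N)) → Hⁿ(Č(lexSystem (M ⊠ N)))` (`OrderedCechSystemBicomplex.totalTensorIso` then `×`) is bijective
(`bijective_homologyMap_tensor_cross`) — the Künneth formula of Stacks 0BEC for the Čech complex of a product cover, in every degree at once.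

Cell `hodgecm-mathlib` (D-0151), F-11 / J3 Künneth packet, brick (K3-alg) = the algebraic form of F-K3 (planner RULINGS #4 (R20)(a)); the geometric
reading (`Modules/CechBoxTensorBicomplex.cechTensorIsoTotal`, affine covers of `X ×_S Y`, `Module.Finite` from properness) is a pure instantiation.
HC_CM is proved only modulo the 7 printed citations until rung 0 closes — nothing here bears on a summit statement.

## References
* The Stacks Project, Tag 0BEC (Künneth formula), Tag 012K. [StacksProject]
* S. Eilenberg, S. Mac Lane, *On the groups `H(Π,n)`, I*, Ann. of Math. 58 (1953), §5. [EilenbergMacLane1953]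
* W. V. Vasconcelos, surjective endomorphisms of finitely generated modules (Mathlib `OrzechProperty`). [folklore]
-/

universe u

open CategoryTheory CategoryTheory.Limits HomologicalComplex

set_option backward.isDefEq.respectTransparency false

noncomputable section

namespace Literature.Algebra.Homology

namespace OrderedCech

variable {A : Type u} [CommRing A] {ι κ : Type} [LinearOrder ι] [LinearOrder κ]
  (P : Finset ι ⥤ Finset κ ⥤ ModuleCat.{u} A)

/-- **`Hⁿ(∇)` is bijective** when `Hⁿ(Č(lexSystem P))` is a finite `A`-module: `Hⁿ(∇)` is onto (it has the section `Hⁿ(×)`), and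
`θ ∘ Hⁿ(∇)` (`θ : Hⁿ(Tot) ≅ Hⁿ(Č(lexSystem P))` the algebraic Eilenberg–Zilber isomorphism) is a surjective endomorphism of a finite module,
hence injective. [cite: StacksProject, Tag 0BEC] [cite: EilenbergMacLane1953, §5] -/
theorem bijective_homologyMap_shuffle (n : ℤ) [Module.Finite A ((sysComplex (lexSystem P)).homology n)] :
    Function.Bijective (HomologicalComplex.homologyMap
      (totalLift (sysBicomplex P) (sysComplex (lexSystem P)) (isZero_sysBicomplex_X_X_of_neg_left P)
        (isZero_sysBicomplex_X_X_of_neg_right P) (fun n a b => ModuleCat.ofHom (shuffleComponent P n a b))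
        (shuffleComponent_comm P)) n).hom := by
  set cr := totalDescHom (sysBicomplex P) (sysComplex (lexSystem P)) (fun a b n => ModuleCat.ofHom (crossComponent P a b n))
    (crossComponent_comm P) with hcr
  set sh := totalLift (sysBicomplex P) (sysComplex (lexSystem P)) (isZero_sysBicomplex_X_X_of_neg_left P)
    (isZero_sysBicomplex_X_X_of_neg_right P) (fun n a b => ModuleCat.ofHom (shuffleComponent P n a b))
    (shuffleComponent_comm P) with hsh
  -- `H(×) ≫ H(∇) = 𝟙`
  have hret : HomologicalComplex.homologyMap cr n ≫ HomologicalComplex.homologyMap sh n = 𝟙 _ := by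
    rw [← HomologicalComplex.homologyMap_comp, hcr, hsh, cross_shuffle, HomologicalComplex.homologyMap_id]
  have hsurj : Function.Surjective (HomologicalComplex.homologyMap sh n).hom := fun y =>
    ⟨(HomologicalComplex.homologyMap cr n).hom y, by rw [← ModuleCat.comp_apply, hret]; rfl⟩
  obtain ⟨θ⟩ := nonempty_homologyIso_total_lexSystem P n
  -- the surjective endomorphism `θ ∘ H(∇)` of the finite module `Hⁿ(Č(lexSystem P))`
  have hφ : Function.Surjective (θ.hom.hom ∘ₗ (HomologicalComplex.homologyMap sh n).hom) :=
    θ.toLinearEquiv.surjective.comp hsurj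
  have hinj := OrzechProperty.injective_of_surjective_endomorphism _ hφ
  exact ⟨Function.Injective.of_comp hinj, hsurj⟩

/-- **`Hⁿ(×)` is bijective** (the inverse of `Hⁿ(∇)`) when `Hⁿ(Č(lexSystem P))` is a finite `A`-module. [cite: StacksProject, Tag 0BEC]
[cite: EilenbergMacLane1953, §5] -/
theorem bijective_homologyMap_cross (n : ℤ) [Module.Finite A ((sysComplex (lexSystem P)).homology n)] :
    Function.Bijective (HomologicalComplex.homologyMap
      (totalDescHom (sysBicomplex P) (sysComplex (lexSystem P)) (fun a b n => ModuleCat.ofHom (crossComponent P a b n))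
        (crossComponent_comm P)) n).hom := by
  set cr := totalDescHom (sysBicomplex P) (sysComplex (lexSystem P)) (fun a b n => ModuleCat.ofHom (crossComponent P a b n))
    (crossComponent_comm P) with hcr
  set sh := totalLift (sysBicomplex P) (sysComplex (lexSystem P)) (isZero_sysBicomplex_X_X_of_neg_left P)
    (isZero_sysBicomplex_X_X_of_neg_right P) (fun n a b => ModuleCat.ofHom (shuffleComponent P n a b))
    (shuffleComponent_comm P) with hsh
  have hret : ∀ x, (HomologicalComplex.homologyMap sh n).hom ((HomologicalComplex.homologyMap cr n).hom x) = x := by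
    intro x
    rw [← ModuleCat.comp_apply, ← HomologicalComplex.homologyMap_comp, hcr, hsh, cross_shuffle, HomologicalComplex.homologyMap_id]
    rfl
  have hs : Function.Bijective (HomologicalComplex.homologyMap sh n).hom := by
    rw [hsh]; exact bijective_homologyMap_shuffle P n
  refine ⟨fun x y hxy => by rw [← hret x, ← hret y, hxy], fun z => ⟨(HomologicalComplex.homologyMap sh n).hom z, hs.1 ?_⟩⟩
  rw [hret]

/-- **The Künneth map of a product pair-system is bijective**: for two systems `M`, `N` on finite index sets, the composite
`Hⁿ(Č(M) ⊗ Č(N)) ≅ Hⁿ(Tot Č•,•(M ⊠ N)) → Hⁿ(Č(lexSystem (M ⊠ N)))` — the identification `totalTensorIso` followed by the cross product — is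
bijective whenever the target is a finite `A`-module (the Čech form of Stacks 0BEC: `Č(M) ⊗ Č(N)` is quasi-isomorphic to the Čech complex of
the product cover). [cite: StacksProject, Tag 0BEC] [cite: EilenbergMacLane1953, §5] -/
theorem bijective_homologyMap_tensor_cross [Fintype ι] [Fintype κ] (M : Finset ι ⥤ ModuleCat.{u} A)
    (N : Finset κ ⥤ ModuleCat.{u} A) (n : ℤ) [Module.Finite A ((sysComplex (lexSystem (prodSystem M N))).homology n)] :
    Function.Bijective (HomologicalComplex.homologyMap ((totalTensorIso M N).hom ≫
      totalDescHom (sysBicomplex (prodSystem M N)) (sysComplex (lexSystem (prodSystem M N)))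
        (fun a b n => ModuleCat.ofHom (crossComponent (prodSystem M N) a b n)) (crossComponent_comm (prodSystem M N))) n).hom := by
  rw [HomologicalComplex.homologyMap_comp, ModuleCat.hom_comp, LinearMap.coe_comp]
  refine (bijective_homologyMap_cross (prodSystem M N) n).comp ?_
  exact ((HomologicalComplex.homologyFunctor _ _ n).mapIso (totalTensorIso M N)).toLinearEquiv.bijective

end OrderedCech

end Literature.Algebra.Homology

end
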